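import Summits.ABC.IUTFork.Thm311RealInd1StripTwistJWKit
import HarnessLib

/-!
# [IUTchIII] Thm 3.11 (i) (Ind1) at `v ∈ 𝕍^non`: the Jannsen–Wingberg KIT, second half — from topological generators of `𝒪_v^≺`
# to ALL units: `log ∘ liftUnits φ = T ∘ log`, the logarithms of generators SPAN `K_v`, and `LiftActsOnUnitLogAs`

PROOF-ONLY file (abc-iut cell, Cor. 3.12 sub-crew, seat abc-iut-c312-1 = holder of record of the typed [IUTchIII] Thm. 3.11,
gen 11; row «R12 JW-TWISTS-FROM-PRESENTATION», part a′).  TAKES NO SIDE on [IUTchIII] Cor. 3.12.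

* **`Real.of_galoisLog_liftUnits_eq_of_generators`** — if a continuous `ℚ_p`-linear `T` of `K_v^{(1/n_v)}` matches
  `log ∘ liftUnits φ` on a set `S` of units topologically generating the principal units, then `log (liftUnits φ w) = T (log w)`
  for EVERY unit `w` (on `⟨S⟩` by multiplicativity; on principal units by `w = d·z^{p^N}`, boundedness of `log` and
  `‖p^N‖ → 0`; on all units through a principal power — no continuity of `liftUnits` needed).
* **`Real.mem_span_of_galoisLog_of_generators`** — under the same hypothesis the logarithms of `S` SPAN `K_v` over `ℚ_p`
  (the spanning half of Hoshi–Nishio 2022 Lemma 1.3: `log(𝒪_v^×)` lies in the closed span and contains a ball).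
* **`Real.liftActsOnUnitLogAs_of_generators`** — the first statement read back through `log_k̄` on `𝒪^⊳_{K̄_v}`: THE equivariant
  lift of `φ` ACTS ON UNIT LOGARITHMS AS `T` (`MLFClosure.LiftActsOnUnitLogAs (closureAt v) p_v _ φ T`, the predicate of this
  lineage's named facts), for any `ℚ_p`-linear `T` of `K_v` matching on generators.
HONEST SCOPE: classical facts about one completion `K_v`; nothing here asserts or refutes [IUTchIII] Cor. 3.12.
[claim: Mochizuki2012, status: disputed] for the (Ind1) vocabulary; [cite: HoshiNishio2022OuterAutMLF, Lemma 1.3];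
[cite: Kondo2025OuterAutMLF, §2 proof of Thm 2.3 p.10].  typed ≠ proved.
-/

set_option autoImplicit false

noncomputable section

open Metric Set
open scoped Pointwise

namespace Summit.ABC.IUTFork.Thm311.Real

open NumberField IsDedekindDomain Literature.NumberTheory.NumberFields Literature.IUT.LogVolume
open Literature.NumberTheory.GaloisRepresentations
open Literature.AnabelianGeometry.AbsoluteAnabelian Literature.IUT.HodgeArakelov
open Literature.IUT.HodgeArakelov.AbsTopMonoids

variable {F : Type} [Field F] [NumberField F] (v : HeightOneSpectrum (𝓞 F))

section Analytic

variable (p : ℕ) [hp : Fact p.Prime] (hv : ((p : ℕ) : 𝓞 F) ∈ v.asIdeal)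

/-! ## 1. From generators to all units: `log ∘ liftUnits φ = T ∘ log`, and the logarithms of generators span -/

/-- **Extension from topological generators to all units.**  Let `S ⊆ 𝒪_v^×` topologically generate the principal units
(every `w` with `|w − 1|_v < 1` lies in the closure of `⟨S⟩` in `K_vˣ`), `φ ∈ Aut_top(G_v)`, and `T` a continuous `ℚ_p`-linear
endomorphism of `K_v^{(1/n_v)}` with `log(liftUnits φ s) = T(log s)` for `s ∈ S` (logarithms read in the rescaled completion).
Then `log(liftUnits φ w) = T(log w)` for EVERY `w ∈ 𝒪_v^×`: on `⟨S⟩` by multiplicativity; on principal units by `w = d·z^{p^N}`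
(`exists_mem_closure_mul_pow`), boundedness of `log` and `‖p^N‖ → 0`; on all units through a principal power (characteristic `0`).
[cite: Kondo2025OuterAutMLF, §2 proof of Thm 2.3 p.10] -/
theorem of_galoisLog_liftUnits_eq_of_generators (S : Set (↥(v.adicCompletionIntegers F))ˣ)
    (hS : ∀ w : (↥(v.adicCompletionIntegers F))ˣ,
      ValuativeRel.valuation (v.adicCompletion F) (((w : ↥(v.adicCompletionIntegers F)) : v.adicCompletion F) - 1) < 1 →
        unitsToK v w ∈ (((Subgroup.closure S).map (unitsToK v)).topologicalClosure : Subgroup (v.adicCompletion F)ˣ))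
    (φ : Gal v ≃ₜ* Gal v) (T : RescaledCompletion F p v hv →L[ℚ_[p]] RescaledCompletion F p v hv)
    (hT : ∀ s ∈ S, RescaledCompletion.of F p v hv (galoisLog v (Additive.ofMul (liftUnits v φ s))) =
      T (RescaledCompletion.of F p v hv (galoisLog v (Additive.ofMul s))))
    (w : (↥(v.adicCompletionIntegers F))ˣ) :
    RescaledCompletion.of F p v hv (galoisLog v (Additive.ofMul (liftUnits v φ w))) =
      T (RescaledCompletion.of F p v hv (galoisLog v (Additive.ofMul w))) := by
  -- the two additive maps `𝒪_v^× → K_v^{(1/n_v)}` and their difference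
  set e := RescaledCompletion.of F p v hv with he
  let f₁ : (↥(v.adicCompletionIntegers F))ˣ →* Multiplicative (RescaledCompletion F p v hv) :=
    { toFun := fun u => Multiplicative.ofAdd (e (galoisLog v (Additive.ofMul (liftUnits v φ u))))
      map_one' := by rw [map_one, ofMul_one, map_zero, map_zero]; rfl
      map_mul' := fun a b => by
        rw [map_mul, ofMul_mul, map_add, map_add]; rfl }
  let f₂ : (↥(v.adicCompletionIntegers F))ˣ →* Multiplicative (RescaledCompletion F p v hv) :=
    { toFun := fun u => Multiplicative.ofAdd (T (e (galoisLog v (Additive.ofMul u))))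
      map_one' := by rw [ofMul_one, map_zero, map_zero, map_zero]; rfl
      map_mul' := fun a b => by
        rw [ofMul_mul, map_add, map_add, map_add]; rfl }
  have hf₁ : ∀ u, (f₁ u).toAdd = e (galoisLog v (Additive.ofMul (liftUnits v φ u))) := fun u => rfl
  have hf₂ : ∀ u, (f₂ u).toAdd = T (e (galoisLog v (Additive.ofMul u))) := fun u => rfl
  let δ : (↥(v.adicCompletionIntegers F))ˣ → RescaledCompletion F p v hv := fun u => (f₁ u).toAdd - (f₂ u).toAdd
  have hδmul : ∀ a b, δ (a * b) = δ a + δ b := by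
    intro a b
    simp only [δ, map_mul, toAdd_mul]
    abel
  have hδpow : ∀ a (n : ℕ), δ (a ^ n) = n • δ a := by
    intro a n
    induction n with
    | zero => simp only [δ, pow_zero, map_one, toAdd_one, sub_self, zero_smul]
    | succ n ih => rw [pow_succ, hδmul, ih, succ_nsmul]
  suffices hδ : δ w = 0 by
    have : (f₁ w).toAdd = (f₂ w).toAdd := sub_eq_zero.mp hδ
    rwa [hf₁, hf₂] at this
  -- (1) `δ = 0` on `⟨S⟩`
  have hgen : ∀ d ∈ Subgroup.closure S, δ d = 0 := by
    intro d hd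
    induction hd using Subgroup.closure_induction with
    | mem s hs => exact sub_eq_zero.mpr (by rw [hf₁, hf₂]; exact hT s hs)
    | one => simp only [δ, map_one, toAdd_one, sub_self]
    | mul a b _ _ ha hb => rw [hδmul, ha, hb, add_zero]
    | inv a _ ha =>
      have h := hδmul a a⁻¹
      rw [mul_inv_cancel] at h
      have h0 : δ 1 = 0 := by simp only [δ, map_one, toAdd_one, sub_self]
      rw [h0, ha, zero_add] at h
      exact h.symm
  -- (2) a uniform bound for `δ`
  obtain ⟨C, hC0, hC⟩ := exists_norm_of_galoisLog_le v p hv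
  obtain ⟨M, hM0, hM⟩ := T.bound
  have hδbd : ∀ z, ‖δ z‖ ≤ C + M * C := by
    intro z
    refine (norm_sub_le _ _).trans (add_le_add ?_ ?_)
    · rw [hf₁]; exact hC _
    · rw [hf₂]; exact (hM _).trans (mul_le_mul_of_nonneg_left (hC _) hM0.le)
  -- (3) principal units: `w = d · z^{p^N}` for every `N`
  have hprinc : ∀ w : (↥(v.adicCompletionIntegers F))ˣ,
      ValuativeRel.valuation (v.adicCompletion F) (((w : ↥(v.adicCompletionIntegers F)) : v.adicCompletion F) - 1) < 1 →
        δ w = 0 := by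
    intro w hw
    apply eq_zero_of_forall_norm_le_norm_prime_pow v p hv (C := C + M * C)
    intro N
    obtain ⟨d, hd, z, rfl⟩ := exists_mem_closure_mul_pow v S (hS w hw) (pow_ne_zero N hp.out.ne_zero)
    rw [hδmul, hgen d hd, zero_add, hδpow, ← Nat.cast_smul_eq_nsmul ℚ_[p], norm_smul, Nat.cast_pow, norm_pow]
    exact mul_le_mul_of_nonneg_left (hδbd z) (pow_nonneg (norm_nonneg _) N)
  -- (4) all units: a principal power
  obtain ⟨k, hk, hwk⟩ := exists_pow_sub_one_lt v p hv w
  have h := hprinc (w ^ k) hwk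
  rw [hδpow, ← Nat.cast_smul_eq_nsmul ℚ_[p]] at h
  have hk0 : ((k : ℕ) : ℚ_[p]) ≠ 0 := by exact_mod_cast hk.ne'
  exact (smul_eq_zero.mp h).resolve_left hk0

/-- **The logarithms of topological generators SPAN `K_v` over `ℚ_p`** (the spanning half of Hoshi–Nishio 2022 Lemma 1.3): if
`S ⊆ 𝒪_v^×` topologically generates the principal units, then every element of `K_v^{(1/n_v)}` is a `ℚ_p`-linear combination of
the `log s`, `s ∈ S` — `log(𝒪_v^×)` lies in the CLOSED span (density, boundedness, `‖p^N‖ → 0`, principal powers) and contains a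
ball. [cite: HoshiNishio2022OuterAutMLF, Lemma 1.3] -/
theorem mem_span_of_galoisLog_of_generators (S : Set (↥(v.adicCompletionIntegers F))ˣ)
    (hS : ∀ w : (↥(v.adicCompletionIntegers F))ˣ,
      ValuativeRel.valuation (v.adicCompletion F) (((w : ↥(v.adicCompletionIntegers F)) : v.adicCompletion F) - 1) < 1 →
        unitsToK v w ∈ (((Subgroup.closure S).map (unitsToK v)).topologicalClosure : Subgroup (v.adicCompletion F)ˣ))
    (z : RescaledCompletion F p v hv) :
    z ∈ Submodule.span ℚ_[p]
      ((fun s : (↥(v.adicCompletionIntegers F))ˣ => RescaledCompletion.of F p v hv (galoisLog v (Additive.ofMul s))) '' S) := by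
  set e := RescaledCompletion.of F p v hv with he
  set W := Submodule.span ℚ_[p]
    ((fun s : (↥(v.adicCompletionIntegers F))ˣ => e (galoisLog v (Additive.ofMul s))) '' S) with hW
  haveI : FiniteDimensional ℚ_[p] (RescaledCompletion F p v hv) := FiniteDimensional.of_locallyCompactSpace ℚ_[p]
  have hWclosed : IsClosed (W : Set (RescaledCompletion F p v hv)) := W.closed_of_finiteDimensional
  -- the logarithm as an additive map into the rescaled completion
  let L : (↥(v.adicCompletionIntegers F))ˣ →* Multiplicative (RescaledCompletion F p v hv) :=
    { toFun := fun u => Multiplicative.ofAdd (e (galoisLog v (Additive.ofMul u)))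
      map_one' := by rw [ofMul_one, map_zero, map_zero]; rfl
      map_mul' := fun a b => by rw [ofMul_mul, map_add, map_add]; rfl }
  have hL : ∀ u, (L u).toAdd = e (galoisLog v (Additive.ofMul u)) := fun u => rfl
  -- (1) `⟨S⟩` maps into `W`
  have hgen : ∀ d ∈ Subgroup.closure S, (L d).toAdd ∈ W := by
    intro d hd
    induction hd using Subgroup.closure_induction with
    | mem s hs => exact Submodule.subset_span ⟨s, hs, rfl⟩
    | one => rw [map_one, toAdd_one]; exact W.zero_mem
    | mul a b _ _ ha hb => rw [map_mul, toAdd_mul]; exact W.add_mem ha hb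
    | inv a _ ha => rw [map_inv, toAdd_inv]; exact W.neg_mem ha
  -- (2) principal units map into `W` (closed)
  obtain ⟨C, hC0, hC⟩ := exists_norm_of_galoisLog_le v p hv
  have hprinc : ∀ w : (↥(v.adicCompletionIntegers F))ˣ,
      ValuativeRel.valuation (v.adicCompletion F) (((w : ↥(v.adicCompletionIntegers F)) : v.adicCompletion F) - 1) < 1 →
        (L w).toAdd ∈ W := by
    intro w hw
    rw [← SetLike.mem_coe, ← hWclosed.closure_eq, Metric.mem_closure_iff]
    intro ε hε
    obtain ⟨N, hN⟩ : ∃ N : ℕ, ‖(p : ℚ_[p])‖ ^ N * C < ε := by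
      have hlim : Filter.Tendsto (fun N : ℕ => ‖(p : ℚ_[p])‖ ^ N * C) Filter.atTop (nhds 0) := by
        have := (tendsto_pow_atTop_nhds_zero_of_lt_one (norm_nonneg _) (Padic.norm_p_lt_one (p := p))).mul_const C
        rwa [zero_mul] at this
      exact (Filter.Tendsto.eventually_lt_const hε hlim).exists
    obtain ⟨d, hd, z, rfl⟩ := exists_mem_closure_mul_pow v S (hS w hw) (pow_ne_zero N hp.out.ne_zero)
    refine ⟨(L d).toAdd, hgen d hd, ?_⟩
    rw [dist_eq_norm, map_mul, toAdd_mul, add_sub_cancel_left, map_pow, toAdd_pow, ← Nat.cast_smul_eq_nsmul ℚ_[p],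
      norm_smul, Nat.cast_pow, norm_pow]
    exact (mul_le_mul_of_nonneg_left (hC z) (pow_nonneg (norm_nonneg _) N)).trans_lt hN
  -- (3) all units map into `W`
  have hall : ∀ w : (↥(v.adicCompletionIntegers F))ˣ, (L w).toAdd ∈ W := by
    intro w
    obtain ⟨k, hk, hwk⟩ := exists_pow_sub_one_lt v p hv w
    have h := hprinc (w ^ k) hwk
    rw [map_pow, toAdd_pow, ← Nat.cast_smul_eq_nsmul ℚ_[p]] at h
    have hk0 : ((k : ℕ) : ℚ_[p]) ≠ 0 := by exact_mod_cast hk.ne'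
    have h' := W.smul_mem ((k : ℕ) : ℚ_[p])⁻¹ h
    rwa [smul_smul, inv_mul_cancel₀ hk0, one_smul] at h'
  -- (4) every `z`: `p^M • z` is small, hence a logarithm
  obtain ⟨M, hM⟩ : ∃ M : ℕ, ‖(p : ℚ_[p])‖ ^ M * ‖z‖ ≤ (p : ℝ) ^ (-(2 : ℝ)) := by
    have hlim : Filter.Tendsto (fun N : ℕ => ‖(p : ℚ_[p])‖ ^ N * ‖z‖) Filter.atTop (nhds 0) := by
      have := (tendsto_pow_atTop_nhds_zero_of_lt_one (norm_nonneg _) (Padic.norm_p_lt_one (p := p))).mul_const ‖z‖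
      rwa [zero_mul] at this
    have hpos : (0 : ℝ) < (p : ℝ) ^ (-(2 : ℝ)) := Real.rpow_pos_of_pos (by exact_mod_cast hp.out.pos) _
    obtain ⟨M, hM⟩ := (Filter.Tendsto.eventually_lt_const hpos hlim).exists
    exact ⟨M, hM.le⟩
  have hsmall : ‖((p : ℕ) : ℚ_[p]) ^ M • z‖ ≤ (p : ℝ) ^ (-(2 : ℝ)) := by
    rw [norm_smul, norm_pow]
    exact hM
  obtain ⟨u, hu⟩ := exists_unit_of_galoisLog_eq_of_norm_le v p hv hsmall
  have hmem : ((p : ℕ) : ℚ_[p]) ^ M • z ∈ W := by rw [← hu]; exact hall u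
  have hp0 : (((p : ℕ) : ℚ_[p]) ^ M) ≠ 0 := pow_ne_zero M (by exact_mod_cast hp.out.ne_zero)
  have h' := W.smul_mem ((((p : ℕ) : ℚ_[p]) ^ M))⁻¹ hmem
  rwa [smul_smul, inv_mul_cancel₀ hp0, one_smul] at h'

end Analytic

/-! ## 2. From generators to `LiftActsOnUnitLogAs` -/

section Generators

variable [Fact (closureAt v).residueChar.Prime]

/-- **THE equivariant lift acts on unit logarithms as `T`, given that it does so on topological generators.**  For
`φ ∈ Aut_top(G_v)` and a `ℚ_p`-linear `T : K_v → K_v` (canonical `ℚ_p`-structure) with `log(liftUnits v φ s) = T(log s)` for all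
`s` in a set `S ⊆ 𝒪_v^×` topologically generating the principal units: `MLFClosure.LiftActsOnUnitLogAs (closureAt v) p _ φ T`.
(Kit: `of_galoisLog_liftUnits_eq_of_generators` in `K_v^{(1/n_v)}`, `T` transported along the `ℚ_p`-linear identity
`K_v ≃ K_v^{(1/n_v)}` and continuous by finite dimension; then the passage `𝒪^⊳_{K̄_v} ⊇ 𝒪_v^×` / `log_k̄|_{𝒪_v^×} = galoisLog`.)
[claim: Mochizuki2012, status: disputed] [cite: Kondo2025OuterAutMLF, §2 proof of Thm 2.3 p.10] -/
theorem liftActsOnUnitLogAs_of_generators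
    (hpk : ValuativeRel.valuation (v.adicCompletion F) (closureAt v).residueChar < 1)
    (S : Set (↥(v.adicCompletionIntegers F))ˣ)
    (hS : ∀ w : (↥(v.adicCompletionIntegers F))ˣ,
      ValuativeRel.valuation (v.adicCompletion F) (((w : ↥(v.adicCompletionIntegers F)) : v.adicCompletion F) - 1) < 1 →
        unitsToK v w ∈ (((Subgroup.closure S).map (unitsToK v)).topologicalClosure : Subgroup (v.adicCompletion F)ˣ))
    (φ : Gal v ≃ₜ* Gal v)
    (T : letI : Algebra ℚ_[(closureAt v).residueChar] (v.adicCompletion F) :=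
        haveI : CharZero (v.adicCompletion F) := charZero_adicCompletion v
        LocalField.padicAlgebra (v.adicCompletion F) (closureAt v).residueChar hpk
      v.adicCompletion F →ₗ[ℚ_[(closureAt v).residueChar]] v.adicCompletion F)
    (hT : ∀ s ∈ S, galoisLog v (Additive.ofMul (liftUnits v φ s)) = T (galoisLog v (Additive.ofMul s))) :
    (closureAt v).LiftActsOnUnitLogAs (closureAt v).residueChar hpk φ T := by
  have hv : (((closureAt v).residueChar : ℕ) : 𝓞 F) ∈ v.asIdeal := natCast_residueChar_closureAt_mem v
  haveI : CharZero (v.adicCompletion F) := charZero_adicCompletion v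
  letI iQ : Algebra ℚ_[(closureAt v).residueChar] (v.adicCompletion F) :=
    LocalField.padicAlgebra (v.adicCompletion F) (closureAt v).residueChar hpk
  haveI : ContinuousSMul ℚ_[(closureAt v).residueChar] (v.adicCompletion F) :=
    continuousSMul_of_algebraMap ℚ_[(closureAt v).residueChar] _
      (by exact LocalField.continuous_algebraMap_adicCompletionPadicAlgebra v (closureAt v).residueChar hv)
  haveI : FiniteDimensional ℚ_[(closureAt v).residueChar] (RescaledCompletion F (closureAt v).residueChar v hv) :=
    FiniteDimensional.of_locallyCompactSpace ℚ_[(closureAt v).residueChar]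
  -- the `ℚ_p`-linear identity `K_v ≃ K_v^{(1/n_v)}`
  let e := RescaledCompletion.of F (closureAt v).residueChar v hv
  let eL : v.adicCompletion F ≃ₗ[ℚ_[(closureAt v).residueChar]] RescaledCompletion F (closureAt v).residueChar v hv :=
    { e.toAddEquiv with
      map_smul' := fun c x => by
        change e (c • x) = c • e x
        rw [Algebra.smul_def, Algebra.smul_def, map_mul]
        rfl }
  have heL : ∀ x, eL x = e x := fun x => rfl
  have heLs : ∀ x, eL.symm x = e.symm x := fun x => rfl
  -- `T` transported, continuous by finite dimension
  let TR : RescaledCompletion F (closureAt v).residueChar v hv →L[ℚ_[(closureAt v).residueChar]]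
      RescaledCompletion F (closureAt v).residueChar v hv :=
    LinearMap.toContinuousLinearMap (eL.toLinearMap ∘ₗ T ∘ₗ eL.symm.toLinearMap)
  have hTR : ∀ z, TR z = e (T (e.symm z)) := fun z => rfl
  have hgen : ∀ s ∈ S, e (galoisLog v (Additive.ofMul (liftUnits v φ s))) = TR (e (galoisLog v (Additive.ofMul s))) := by
    intro s hs
    rw [hTR, RingEquiv.symm_apply_apply, hT s hs]
  have hall := of_galoisLog_liftUnits_eq_of_generators v (closureAt v).residueChar hv S hS φ TR hgen
  -- read back on `𝒪^⊳_{K̄_v}`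
  intro x x' a a' t t' hxunit hxa hxa' hlift hlog hlog'
  obtain ⟨w, hwx, hwa⟩ := exists_toOUnits_coe_eq_of_isUnit v hxunit hxa
  -- `a' = liftUnits v φ w`
  have ha' : a' = ((liftUnits v φ w : ↥(v.adicCompletionIntegers F)) : v.adicCompletion F) := by
    apply (algebraMap (v.adicCompletion F) (AlgebraicClosure (v.adicCompletion F))).injective
    rw [← hxa', ← hlift, ← coe_liftM_toOUnits v φ w, hwx]
  -- `t = log w`, `t' = log (liftUnits v φ w)`
  have ht : t = galoisLog v (Additive.ofMul w) := by
    apply (algebraMap (v.adicCompletion F) (AlgebraicClosure (v.adicCompletion F))).injective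
    rw [← hlog, algebraMap_galoisLog, hwa]
    rfl
  have ht' : t' = galoisLog v (Additive.ofMul (liftUnits v φ w)) := by
    apply (algebraMap (v.adicCompletion F) (AlgebraicClosure (v.adicCompletion F))).injective
    rw [← hlog', algebraMap_galoisLog, ha']
    rfl
  rw [ht, ht']
  apply e.injective
  rw [hall w, hTR, RingEquiv.symm_apply_apply]

end Generators

end Summit.ABC.IUTFork.Thm311.Real

end
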